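import Mathlib
import HarnessLib
import Literature.Computability.AlgebraicComplexity.TensorRestrictionRank
import Literature.Computability.AlgebraicComplexity.CoppersmithWinograd1990Proofs
import Literature.Computability.AlgebraicComplexity.BigCwFourthOmega

/-!
# OutsiderSandwichLaserMerge, part 1/2 — the laser-merge rate on powers of `cw₂` (core, no route import)

Landing chain `OutsiderSandwichLaserMergeCore` → `OutsiderSandwichLaserMerge` for the route
`Summits/…/Theses/OutsiderSandwich.lean` (`route-MatrixMultiplication-OutsiderSandwich`, rev 3), cell `decomp-mm`
lens 4, generation 5 (each file ≤ 400 lines; this helper imports no `Theses` file, gate lint `theses-cone`).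
Land FIRST with

  `ledger propose --kind proof --target Summits/MatrixMultiplication/MatrixMultiplication/Theorems/OutsiderSandwichLaserMergeCore.lean
     --file OutsiderSandwichLaserMergeCore.lean --supports stmt-MatrixMultiplication-28622`

CONTENT (sorry-free, no hypothesis beyond `1 ≤ c`): for every `1 ≤ c < 2^{ℓ(ω)}`,
`ℓ(ω) = 2/3 + (2/ω)(log₂ 3 − 2/3)`, cofinally in `N` some `⟨n,n,n⟩ ≤ cw₂^{⊠N}` has `c^N ≤ n²`
(`cwTwoRate_laserMerge_of_one_le`).  This is the THEOREM-IN-PRINT rung of the route's ladder: the little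
Coppersmith–Winograd tensor `cw₂ = T_cw,2`, laser method with zeroing-out along a free diagonal of balanced
types (BCS Thm. 15.41, proof p. 381: `cw₂^{⊠3m} ≥ ⟨p_m⟩ ⊗ ⟨2^m,2^m,2^m⟩`, `p_m ≥ C(3m,m)·2^{-o(m)}` — in the
tree as the genuine restriction `exists_restrictsTo_cw_kroneckerPow`, repackaged here as `laserBlocks`), then
MERGING the `p` independent products into one `⟨a·2^m⟩³` with `R(⟨a,a,a⟩) ≤ p` (`ω + δ` admissible:
`exists_tensorRank_matMulTensor_le_rpow`; `R(s) ≤ p ⇒ ⟨p⟩ ≥ s`: `tensorRestrictsTo_unitTensor_of_tensorRank_le`).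
Per copy of `cw₂` the matrix side is `2^{2ℓ(ω)(1-o(1))}` with `3ℓ(ω) = 2 + (2/ω) log₂(27/4)`
(`three_mul_ell_mul_log_two`); `1 < 2^{ℓ(w)}` for `w > 0` (`one_lt_two_rpow_ell`).

References: [BurgisserClausenShokrollahi1997, Thm. 15.41 and its proof p. 381; §15.5 p. 425],
[CoppersmithWinograd1990, §6], [Blaser2013, §5.2 p. 24, §8], [ConnerGesmundoLandsbergVentura2022, §1 p. 3].
-/

set_option linter.dupNamespace false -- `MatrixMultiplication.MatrixMultiplication` (summit = problem, D-0017)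

namespace Summit.MatrixMultiplication.MatrixMultiplication.Theorems.OutsiderSandwichLaserMerge

open scoped BigOperators
open Literature.Computability.AlgebraicComplexity

/-! ## The zeroing step with its effective count (BCS Thm. 15.41, proof) -/

/-- **Laser zeroing for `cw₂` with an effective block count**: for every `m ≥ 1` there is `p` with
`cw₂^{⊠3m} ≥ ⟨p⟩ ⊗ ⟨2^m,2^m,2^m⟩` and `log p ≥ m·log(27/4) − 12√m − log 96`
(from `288·C(2m,m)·p ≥ C(3m,m)·r₃(3C(2m,m))`, `C(3m,m) ≥ (27/4)^m/(3m+1)` and Behrend's bound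
`r₃(M) ≥ M·exp(−4√(log M))`). [cite: BurgisserClausenShokrollahi1997, Thm. 15.41 (proof, p. 381)] -/
theorem laserBlocks (m : ℕ) (hm : 1 ≤ m) : ∃ p : ℕ, 0 < (p : ℝ) ∧
    (m : ℝ) * Real.log (27 / 4) - 12 * √(m : ℝ) - Real.log 96 ≤ Real.log p ∧
    TensorRestrictsTo (kroneckerPow (cwTensor ℂ 2) (3 * m))
      (kroneckerTensor (unitTensor ℂ p) (matMulTensor ℂ (2 ^ m) (2 ^ m) (2 ^ m))) := by
  classical
  obtain ⟨p, hpsize, hres⟩ := exists_restrictsTo_cw_kroneckerPow ℂ 2 m hm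
  have hlog3 : Real.log 3 ≤ 2 := by
    rw [Real.log_le_iff_le_exp (by norm_num)]; linarith [exp_two_gt]
  have hlog4 : Real.log 4 ≤ 2 := by
    rw [Real.log_le_iff_le_exp (by norm_num)]; linarith [exp_two_gt]
  have hm1 : (1 : ℝ) ≤ m := by exact_mod_cast hm
  set f := (2 * m).choose m with hf
  have hf1 : 1 ≤ f := Nat.choose_pos (by omega)
  have hf0 : (0 : ℝ) < f := by exact_mod_cast hf1
  have hf4 : (f : ℝ) ≤ 4 ^ m := by
    have : f ≤ 2 ^ (2 * m) := Nat.choose_le_two_pow _ _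
    calc (f : ℝ) ≤ ((2 ^ (2 * m) : ℕ) : ℝ) := by exact_mod_cast this
      _ = 4 ^ m := by push_cast; rw [pow_mul]; norm_num
  -- Behrend
  have hB := Behrend.roth_lower_bound (N := 3 * f)
  have hsize : ((3 * m).choose m : ℝ) * rothNumberNat (3 * f) ≤ 288 * f * p := by
    exact_mod_cast hpsize
  set s : ℝ := 4 * √(Real.log ((3 * f : ℕ) : ℝ)) with hs
  have hexp : 0 < Real.exp (-s) := Real.exp_pos _
  have hB' : ((3 * f : ℕ) : ℝ) * Real.exp (-s) ≤ rothNumberNat (3 * f) := by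
    rw [hs, show -(4 * √(Real.log ((3 * f : ℕ) : ℝ))) = -4 * √(Real.log ((3 * f : ℕ) : ℝ)) by ring]
    exact hB
  have hC0 : (0 : ℝ) ≤ (3 * m).choose m := Nat.cast_nonneg _
  -- `C e^{-s} ≤ 96 p`
  have h1 : ((3 * m).choose m : ℝ) * Real.exp (-s) ≤ 96 * p := by
    have h3f : (0 : ℝ) < ((3 * f : ℕ) : ℝ) := by positivity
    refine le_of_mul_le_mul_right ?_ h3f
    calc ((3 * m).choose m : ℝ) * Real.exp (-s) * ((3 * f : ℕ) : ℝ)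
        = ((3 * m).choose m : ℝ) * (((3 * f : ℕ) : ℝ) * Real.exp (-s)) := by ring
      _ ≤ ((3 * m).choose m : ℝ) * rothNumberNat (3 * f) := mul_le_mul_of_nonneg_left hB' hC0
      _ ≤ 288 * f * p := hsize
      _ = 96 * p * ((3 * f : ℕ) : ℝ) := by push_cast; ring
  have hp0 : 0 < (p : ℝ) := by
    have : 0 < ((3 * m).choose m : ℝ) * Real.exp (-s) :=
      mul_pos (by exact_mod_cast Nat.choose_pos (by omega)) hexp
    linarith
  refine ⟨p, hp0, ?_, hres⟩
  -- `(27/4)^m e^{-s} ≤ 96 (3m+1) p`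
  have h2 : ((27 : ℝ) / 4) ^ m * Real.exp (-s) ≤ 96 * (3 * m + 1) * p := by
    calc ((27 : ℝ) / 4) ^ m * Real.exp (-s)
        ≤ (3 * m + 1) * ((3 * m).choose m : ℝ) * Real.exp (-s) :=
          mul_le_mul_of_nonneg_right (pow_le_mul_choose_three_mul m) hexp.le
      _ = (3 * m + 1) * (((3 * m).choose m : ℝ) * Real.exp (-s)) := by ring
      _ ≤ (3 * m + 1) * (96 * p) := mul_le_mul_of_nonneg_left h1 (by positivity)
      _ = 96 * (3 * m + 1) * p := by ring
  have h3 : (m : ℝ) * Real.log (27 / 4) - s ≤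
      Real.log 96 + Real.log (3 * m + 1) + Real.log p := by
    have hlhs : Real.log (((27 : ℝ) / 4) ^ m * Real.exp (-s)) = m * Real.log (27 / 4) - s := by
      rw [Real.log_mul (by positivity) hexp.ne', Real.log_pow, Real.log_exp]; ring
    have hrhs : Real.log (96 * (3 * m + 1) * p) =
        Real.log 96 + Real.log (3 * m + 1) + Real.log p := by
      rw [Real.log_mul (by positivity) hp0.ne', Real.log_mul (by norm_num) (by positivity)]
    rw [← hlhs, ← hrhs]
    exact Real.log_le_log (by positivity) h2
  -- `s ≤ 8 √m` and `log (3m+1) ≤ 4 √m`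
  have hs8 : s ≤ 8 * √(m : ℝ) := by
    have hlog3f : Real.log ((3 * f : ℕ) : ℝ) ≤ 4 * m := by
      have : ((3 * f : ℕ) : ℝ) ≤ 3 * 4 ^ m := by push_cast; linarith
      calc Real.log ((3 * f : ℕ) : ℝ) ≤ Real.log (3 * 4 ^ m) :=
            Real.log_le_log (by positivity) this
        _ = Real.log 3 + m * Real.log 4 := by
            rw [Real.log_mul (by norm_num) (by positivity), Real.log_pow]
        _ ≤ 2 + m * 2 := by nlinarith
        _ ≤ 4 * m := by linarith
    have : √(Real.log ((3 * f : ℕ) : ℝ)) ≤ 2 * √(m : ℝ) := by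
      calc √(Real.log ((3 * f : ℕ) : ℝ)) ≤ √(4 * m) := Real.sqrt_le_sqrt hlog3f
        _ = 2 * √(m : ℝ) := by
            rw [Real.sqrt_mul (by norm_num), show (4 : ℝ) = 2 ^ 2 by norm_num,
              Real.sqrt_sq (by norm_num)]
    rw [hs]; linarith
  have hl4 : Real.log (3 * m + 1) ≤ 4 * √(m : ℝ) := by
    calc Real.log (3 * m + 1) ≤ 2 * √(3 * m + 1) := log_le_two_mul_sqrt (by positivity)
      _ ≤ 2 * √(4 * m) := by
          refine mul_le_mul_of_nonneg_left (Real.sqrt_le_sqrt (by linarith)) (by norm_num)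
      _ = 4 * √(m : ℝ) := by
          rw [Real.sqrt_mul (by norm_num), show (4 : ℝ) = 2 ^ 2 by norm_num,
            Real.sqrt_sq (by norm_num)]; ring
  linarith

/-! ## The merge and the rate -/

/-- `3·ℓ(ω)·log 2 = 2 log 2 + 2 log(27/4)/ω`: the exponent of the item in nats. [this route, g5] -/
theorem three_mul_ell_mul_log_two (w : ℝ) (hw : w ≠ 0) :
    3 * ((2 / 3 + 2 / w * (Real.logb 2 3 - 2 / 3)) * Real.log 2) =
      2 * Real.log 2 + 2 * Real.log (27 / 4) / w := by
  have hlog2 : Real.log 2 ≠ 0 := (Real.log_pos one_lt_two).ne'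
  rw [Real.logb, show (27 : ℝ) / 4 = 3 ^ 3 / 2 ^ 2 by norm_num,
    Real.log_div (by norm_num) (by norm_num), Real.log_pow, Real.log_pow]
  field_simp
  push_cast
  ring

/-- **The laser-merge rung for `1 ≤ c < 2^{ℓ(ω)}`**: for every `N₀` there are `N = 3m ≥ N₀` and
`a` with `cw₂^{⊠N} ≥ ⟨a·2^m, a·2^m, a·2^m⟩` and `c^N ≤ (a·2^m)²`.  Proof: `laserBlocks` gives
`cw₂^{⊠3m} ≥ ⟨p⟩ ⊗ ⟨2^m⟩³` with `log p ≥ m log(27/4) − O(√m)`; with `δ = gap/log(27/4)` and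
`a = ⌊(p/C_δ)^{1/(ω+δ)}⌋`, `R(⟨a,a,a⟩) ≤ C_δ a^{ω+δ} ≤ p`, so `⟨p⟩ ≥ ⟨a,a,a⟩` and
`cw₂^{⊠3m} ≥ ⟨a⟩³ ⊗ ⟨2^m⟩³ ≥ ⟨a 2^m⟩³`; finally `2 log a + 2m log 2 ≥ 3m log c` for `m` large.
[cite: BurgisserClausenShokrollahi1997, Thm. 15.41 (proof p. 381) and §15.5 (p. 425)] -/
theorem cwTwoRate_laserMerge_of_one_le {c : ℝ} (hc1 : 1 ≤ c)
    (hc : c < (2 : ℝ) ^ (2 / 3 + 2 / omega ℂ * (Real.logb 2 3 - 2 / 3))) (N₀ : ℕ) :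
    ∃ N : ℕ, N₀ ≤ N ∧ ∃ n : ℕ,
      TensorRestrictsTo (kroneckerPow (cwTensor ℂ 2) N) (matMulTensor ℂ n n n) ∧
        c ^ N ≤ (n : ℝ) ^ 2 := by
  classical
  have hω2 : 2 ≤ omega ℂ := omega_two_le ℂ
  obtain ⟨ω, hωdef⟩ : ∃ ω : ℝ, ω = omega ℂ := ⟨_, rfl⟩
  rw [← hωdef] at hc hω2
  have hω0 : 0 < ω := by linarith
  obtain ⟨L, hL⟩ : ∃ L : ℝ, L = Real.log (27 / 4) := ⟨_, rfl⟩
  have hL0 : 0 < L := hL ▸ Real.log_pos (by norm_num)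
  have hlog2 : 0 < Real.log 2 := Real.log_pos one_lt_two
  have hc0 : 0 < c := by linarith
  -- the gap `g = 3ℓ log 2 − 3 log c > 0`
  have hgap : 3 * Real.log c < 2 * Real.log 2 + 2 * L / ω := by
    have h1 : Real.log c < (2 / 3 + 2 / ω * (Real.logb 2 3 - 2 / 3)) * Real.log 2 := by
      have := Real.log_lt_log hc0 hc
      rwa [Real.log_rpow two_pos] at this
    have e := three_mul_ell_mul_log_two ω hω0.ne'
    rw [← hL] at e
    linarith
  obtain ⟨g, hg⟩ : ∃ g : ℝ, g = 2 * Real.log 2 + 2 * L / ω - 3 * Real.log c := ⟨_, rfl⟩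
  have hg0 : 0 < g := by rw [hg]; linarith
  -- `δ := g / L`, so that `2L/ω − 2L/(ω+δ) ≤ g/2`
  obtain ⟨δ, hδ⟩ : ∃ δ : ℝ, δ = g / L := ⟨_, rfl⟩
  have hδ0 : 0 < δ := hδ ▸ div_pos hg0 hL0
  have hωδ : 0 < ω + δ := by linarith
  have hδloss : 2 * L / ω - 2 * L / (ω + δ) ≤ g / 2 := by
    have hLδ : L * δ = g := by rw [hδ]; field_simp
    have h4 : 4 ≤ ω * (ω + δ) := by nlinarith
    have e1 : 2 * L / ω - 2 * L / (ω + δ) = 2 * (L * δ) / (ω * (ω + δ)) := by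
      field_simp
      ring
    rw [e1, hLδ, div_le_iff₀ (by positivity)]
    nlinarith
  -- `ω + δ` is an admissible exponent
  obtain ⟨Cδ, hCδ, hCδb⟩ := exists_tensorRank_matMulTensor_le_rpow ℂ hδ0
  rw [← hωdef] at hCδb
  -- thresholds in `m`
  obtain ⟨m₁, hm₁⟩ := exists_nat_forall_sqrt_le 12
    (Real.log 96 + Real.log Cδ + (ω + δ) * Real.log 2) L hL0
  obtain ⟨m₂, hm₂⟩ := exists_nat_forall_sqrt_le 12
    (|Real.log 96 + Real.log Cδ| + 2 * Real.log 2) (g / 2) (by linarith)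
  obtain ⟨m, hmdef⟩ : ∃ m : ℕ, m = max (max m₁ m₂) (max N₀ 1) := ⟨_, rfl⟩
  have hm1 : 1 ≤ m := by rw [hmdef]; omega
  have hmm₁ : m₁ ≤ m := by rw [hmdef]; omega
  have hmm₂ : m₂ ≤ m := by rw [hmdef]; omega
  have hmN₀ : N₀ ≤ m := by rw [hmdef]; omega
  have hm0 : (0 : ℝ) ≤ m := Nat.cast_nonneg m
  -- the zeroing step
  obtain ⟨p, hp0, hlogp, hres⟩ := laserBlocks m hm1
  rw [← hL] at hlogp
  have hthr₁ := hm₁ m hmm₁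
  have hthr₂ := hm₂ m hmm₂
  -- `X = (p/Cδ)^{1/(ω+δ)} ≥ 2`, `a = ⌊X⌋`
  obtain ⟨X, hX⟩ : ∃ X : ℝ, X = ((p : ℝ) / Cδ) ^ (ω + δ)⁻¹ := ⟨_, rfl⟩
  have hPC : 0 < (p : ℝ) / Cδ := div_pos hp0 hCδ
  have hX0 : 0 ≤ X := hX ▸ Real.rpow_nonneg hPC.le _
  have hlogX : Real.log X = (Real.log p - Real.log Cδ) / (ω + δ) := by
    rw [hX, Real.log_rpow hPC, Real.log_div hp0.ne' hCδ.ne']; ring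
  have hX2 : 2 ≤ X := by
    have h2 : (2 : ℝ) ^ (ω + δ) ≤ (p : ℝ) / Cδ := by
      rw [← Real.log_le_log_iff (by positivity) hPC, Real.log_rpow (by norm_num),
        Real.log_div hp0.ne' hCδ.ne']
      linarith
    calc (2 : ℝ) = ((2 : ℝ) ^ (ω + δ)) ^ (ω + δ)⁻¹ :=
          (Real.rpow_rpow_inv (by norm_num) hωδ.ne').symm
      _ ≤ X := hX ▸ Real.rpow_le_rpow (by positivity) h2 (inv_nonneg.2 hωδ.le)
  obtain ⟨a, ha⟩ : ∃ a : ℕ, a = ⌊X⌋₊ := ⟨_, rfl⟩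
  have ha2 : 2 ≤ a := ha ▸ Nat.le_floor (by exact_mod_cast hX2)
  have haX : (a : ℝ) ≤ X := ha ▸ Nat.floor_le hX0
  have haX' : X / 2 ≤ a := by have := Nat.lt_floor_add_one X; rw [← ha] at this; linarith
  have ha0 : (0 : ℝ) < a := by exact_mod_cast (by omega : 0 < a)
  -- `R(⟨a,a,a⟩) ≤ p`
  have hap : tensorRank (matMulTensor ℂ a a a) ≤ p := by
    have h1 := hCδb a (by omega)
    have h2 : (a : ℝ) ^ (ω + δ) ≤ X ^ (ω + δ) := Real.rpow_le_rpow ha0.le haX hωδ.le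
    have h3 : X ^ (ω + δ) = (p : ℝ) / Cδ := by
      rw [hX]; exact Real.rpow_inv_rpow hPC.le hωδ.ne'
    have h4 : (tensorRank (matMulTensor ℂ a a a) : ℝ) ≤ p := by
      calc (tensorRank (matMulTensor ℂ a a a) : ℝ) ≤ Cδ * (a : ℝ) ^ (ω + δ) := h1
        _ ≤ Cδ * X ^ (ω + δ) := mul_le_mul_of_nonneg_left h2 hCδ.le
        _ = p := by rw [h3]; field_simp
    exact_mod_cast h4
  -- relabelling `⟨a,a,a⟩ ⊗ ⟨2^m,2^m,2^m⟩ ≥ ⟨a·2^m, a·2^m, a·2^m⟩` (Bläser 2013 §5.2 p. 24; a local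
  -- `have`, not a lemma: the same statement lands with the companion chain `OutsiderSandwichHalfMM`)
  have hkm : TensorRestrictsTo
      (kroneckerTensor (matMulTensor ℂ a a a) (matMulTensor ℂ (2 ^ m) (2 ^ m) (2 ^ m)))
      (matMulTensor ℂ (a * 2 ^ m) (a * 2 ^ m) (a * 2 ^ m)) := by
    have e : kroneckerTensor (matMulTensor ℂ a a a) (matMulTensor ℂ (2 ^ m) (2 ^ m) (2 ^ m)) =
        fun x y z => matMulTensor ℂ (a * 2 ^ m) (a * 2 ^ m) (a * 2 ^ m)
          (doubleIndexEquiv a a (2 ^ m) (2 ^ m) x) (doubleIndexEquiv a a (2 ^ m) (2 ^ m) y)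
          (doubleIndexEquiv a a (2 ^ m) (2 ^ m) z) := by
      funext x y z
      exact kroneckerTensor_matMulTensor (K := ℂ) a a a (2 ^ m) (2 ^ m) (2 ^ m) x y z
    rw [e]
    exact tensorRestrictsTo_of_reindex (matMulTensor ℂ _ _ _) _ _ _
  -- the merged restriction `cw₂^{⊠3m} ≥ ⟨a 2^m, a 2^m, a 2^m⟩`
  have hres' : TensorRestrictsTo (kroneckerPow (cwTensor ℂ 2) (3 * m))
      (matMulTensor ℂ (a * 2 ^ m) (a * 2 ^ m) (a * 2 ^ m)) :=
    (hres.trans ((tensorRestrictsTo_unitTensor_of_tensorRank_le _ hap).kronecker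
      (TensorRestrictsTo.refl (matMulTensor ℂ (2 ^ m) (2 ^ m) (2 ^ m))))).trans
      hkm
  refine ⟨3 * m, by omega, a * 2 ^ m, hres', ?_⟩
  -- the inequality `c^{3m} ≤ (a 2^m)²`, via logarithms
  have hloga : Real.log X - Real.log 2 ≤ Real.log a := by
    have := Real.log_le_log (by positivity) haX'
    rwa [Real.log_div (by positivity) (by norm_num)] at this
  have h2ωδ : 2 / (ω + δ) ≤ 1 := by rw [div_le_one hωδ]; linarith
  have h2ωδ0 : 0 ≤ 2 / (ω + δ) := by positivity
  -- lower bound for `2 log a`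
  have hA : 2 / (ω + δ) * ((m : ℝ) * L) -
      (2 / (ω + δ) * (12 * √(m : ℝ) + Real.log 96 + Real.log Cδ) + 2 * Real.log 2) ≤
      2 * Real.log a := by
    have h2X : 2 * Real.log X = 2 / (ω + δ) * (Real.log p - Real.log Cδ) := by
      rw [hlogX]; ring
    have h3 : 2 / (ω + δ) * ((m : ℝ) * L - 12 * √(m : ℝ) - Real.log 96 - Real.log Cδ) ≤
        2 / (ω + δ) * (Real.log p - Real.log Cδ) :=
      mul_le_mul_of_nonneg_left (by linarith) h2ωδ0
    have h4 : 2 / (ω + δ) * ((m : ℝ) * L - 12 * √(m : ℝ) - Real.log 96 - Real.log Cδ) =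
        2 / (ω + δ) * ((m : ℝ) * L) -
          2 / (ω + δ) * (12 * √(m : ℝ) + Real.log 96 + Real.log Cδ) := by ring
    linarith
  -- the error term is `≤ (g/2) m`
  have hE : 2 / (ω + δ) * (12 * √(m : ℝ) + Real.log 96 + Real.log Cδ) + 2 * Real.log 2 ≤
      g / 2 * m := by
    have hsq : 0 ≤ √(m : ℝ) := Real.sqrt_nonneg _
    have hx : 12 * √(m : ℝ) + Real.log 96 + Real.log Cδ ≤
        12 * √(m : ℝ) + |Real.log 96 + Real.log Cδ| := by
      linarith [le_abs_self (Real.log 96 + Real.log Cδ)]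
    have habs : 0 ≤ 12 * √(m : ℝ) + |Real.log 96 + Real.log Cδ| := by positivity
    have h1 : 2 / (ω + δ) * (12 * √(m : ℝ) + Real.log 96 + Real.log Cδ) ≤
        12 * √(m : ℝ) + |Real.log 96 + Real.log Cδ| := by
      calc 2 / (ω + δ) * (12 * √(m : ℝ) + Real.log 96 + Real.log Cδ)
          ≤ 2 / (ω + δ) * (12 * √(m : ℝ) + |Real.log 96 + Real.log Cδ|) :=
            mul_le_mul_of_nonneg_left hx h2ωδ0
        _ ≤ 1 * (12 * √(m : ℝ) + |Real.log 96 + Real.log Cδ|) :=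
            mul_le_mul_of_nonneg_right h2ωδ habs
        _ = 12 * √(m : ℝ) + |Real.log 96 + Real.log Cδ| := one_mul _
    linarith
  -- the main term: `m (3 log c + g/2) ≤ m (2L/(ω+δ) + 2 log 2)`
  have hmain : 3 * (m : ℝ) * Real.log c + g / 2 * m ≤
      2 / (ω + δ) * ((m : ℝ) * L) + 2 * m * Real.log 2 := by
    have hper : 3 * Real.log c + g / 2 ≤ 2 * L / (ω + δ) + 2 * Real.log 2 := by
      rw [hg]; linarith
    have e1 : 2 / (ω + δ) * ((m : ℝ) * L) + 2 * m * Real.log 2 =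
        m * (2 * L / (ω + δ) + 2 * Real.log 2) := by ring
    have e2 : 3 * (m : ℝ) * Real.log c + g / 2 * m = m * (3 * Real.log c + g / 2) := by ring
    rw [e1, e2]
    exact mul_le_mul_of_nonneg_left hper hm0
  have key : 3 * (m : ℝ) * Real.log c ≤ 2 * Real.log a + 2 * m * Real.log 2 := by linarith
  have han0 : (0 : ℝ) < ((a * 2 ^ m : ℕ) : ℝ) := by positivity
  have hfinal : Real.log (c ^ (3 * m)) ≤ Real.log (((a * 2 ^ m : ℕ) : ℝ) ^ 2) := by
    rw [Real.log_pow, Real.log_pow]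
    push_cast
    rw [Real.log_mul ha0.ne' (by positivity), Real.log_pow]
    linarith
  exact (Real.log_le_log_iff (by positivity) (by positivity)).1 hfinal

/-- `1 < 2^{ℓ(ω')}` for every `ω' > 0` (the exponent is positive since `log₂ 3 > 1 > 2/3`).
[this route, g5] -/
theorem one_lt_two_rpow_ell {w : ℝ} (hw : 0 < w) :
    (1 : ℝ) < (2 : ℝ) ^ (2 / 3 + 2 / w * (Real.logb 2 3 - 2 / 3)) := by
  apply Real.one_lt_rpow one_lt_two
  have h1 : 1 < Real.logb 2 3 := by
    rw [Real.lt_logb_iff_rpow_lt (by norm_num) (by norm_num), Real.rpow_one]; norm_num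
  have : 0 < 2 / w * (Real.logb 2 3 - 2 / 3) := mul_pos (div_pos two_pos hw) (by linarith)
  linarith

end Summit.MatrixMultiplication.MatrixMultiplication.Theorems.OutsiderSandwichLaserMerge
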